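import Summits.QuantumFields.YangMills.Theorems.IR.AfPincerUcTypChainReduced
import Summits.QuantumFields.YangMills.Theorems.IR.Negative.OnsetSharpFalseOfUnpinnedUnit
import Summits.QuantumFields.YangMills.Theorems.IR.Negative.ClauseITypChainDeepFalseOfFilmWire
import HarnessLib

/-!
# Crux `IR` (stmt-QuantumFields-19354), line `af-pincer-Uc-sharp` — NEGATIVE side of the class of record `TypChain`:
# it reads walls only at the scale `ℓ₀`; every scale below is admitted as arbitrary PATCH data; the typed price (patch-film wire)

Negative knowledge for item `stmt-QuantumFields-19354` (`--supports`; closes no stub; verdict of record NOT-REFUTED unchanged; slot «sharp merge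
I♯_SC» `Cruxes/IR/Lines/af_pincer_Uc_sharp.lean` sha16 `28967a1bf60ad397` UNTOUCHED).  Author: refuter `ym-19354-disprove-1` GEN 13 (event-less
re-seat; the probe named by GEN 12's memo §18.4 (2) for a successor), companion of GEN 12's `Negative/ClauseITypChainDeepFalseOfFilmWire` (p562545).

WHY.  The lane-A class of record for the format's `∃ Typ` is the short-chain class `TypChain r.ρ θ w ℓ₀` (owner R112; suppliers
`TypChainSharpSC` p539933, `TypChainReducedAtSC` ∕ `TypChainReducedSC` p544202): NO `θ`-bad chain (steps of `ℓ∞`-length `≤ 2`) of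
end-to-end extent `≥ ℓ₀` among the cell's plaquettes.  GEN 12 recorded that the DEEP re-cut `TypChainDeep` stops reading the boundary layers
where designed films live, and typed the price (`DeepFilmWireAt`).  THIS FILE records that the depth-0 class reads walls ONLY AT THE SCALE `ℓ₀`:
below it, everything is admitted —
* §1 `IsPatchwork B ℓ` (plaquettes labelled so that chain-neighbours share a label and equal labels are within `ℓ∞`-distance `ℓ`),
  `PatchClean w ℓ c σ` (identity off an `ℓ`-patchwork, free on it), **`mem_typChain_of_patchClean`**: patch-clean data at scale `ℓ` lie in
  `TypChain ρ θ w ℓ₀ c` for EVERY `θ > 0` and EVERY `ℓ₀ > ℓ` (the label is constant along a bad chain); explicit members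
  **`boxConfig_mem_typChain`**: ARBITRARY prescribed data on the edges based in any box `x₀ + [0, ℓ)⁴`, identity elsewhere, are admitted in
  every cell of every frame at every `θ > 0` as soon as `ℓ < ℓ₀` — e.g. this lineage's GEN 2 film designs (`haar`, `z2pert`; memo §7.2) cut to
  boxes of side `ℓ₀ − 1`, or faces TILED by such boxes with clean corridors of width `3` between them (pairwise `> 2` apart: one label each).
* The extent is not the supplier's to keep small: clause (ii) (`ClauseIIukp`, atypical cells rare UNIFORMLY over the meshes `b` it serves,
  `a β · b < T`, `b ≤ B e^{Cβ}`) needs `ℓ₀` above the length of the `θ`-bad chains a mesh-`b` cell typically carries at coupling `β`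
  (`≍ 8C/(cθ)` by counting: `b⁴ e^{−cθβL/2}` expected chains of length `L`), and the REDUCED supplier prints exactly
  `ℓ₀ = extentOf θ κ C = 2 · max ⌈48 C⁺/θ⌉₊ ⌈4 C⁺/κ⌉₊` (p544202 §2) — hundreds of lattice units at the asymptotic-freedom mesh growth,
  against a film wall width of `4–8` lattice units in the GEN 2 census.  (Located remark; the counting is not a kernel statement.)
* §2 **`PatchFilmWireAt ρ ℓ n η`** — the film scenario for PATCHWORK faces of scale `ℓ`, typed uniformly in the mesh and verbatim against
  `FixedMesh.ClauseI` (shape of p562545's `DeepFilmWireAt` with «core-clean at depth `D`» replaced by «patch-clean at scale `ℓ`»);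
  `not_clauseI_typChain_of_instance`, **`exists_frame_not_clauseIAll_of_wireAt`**: the wire at scale `ℓ` ⇒ for all large `β`, every mesh
  `b ≥ 1`, every `θ > 0`, every `ε ≤ η`, EVERY `ℓ₀ > ℓ`, some mesh-`b` frame violates `ClauseI` and `ClauseIAll` for `TypChain ρ θ w ℓ₀`.
* §3 calibration of the three supplier statements BY NAME: **`typChainSharpSC_avoids_patchWire`** (a witness prints `(n, ε, θ, ℓ₀)` with
  `¬ PatchFilmWireAt r.ρ ℓ n η` for every `ℓ < ℓ₀`, `η ≥ 1/16`), **`typChainReducedAtSC_avoids_patchWire`** (every `ℓ < extentOf θ κ C`),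
  **`typChainReducedSC_avoids_patchWire_all_scales`** (the every-extent statement must exclude patch-film order at EVERY scale — the very
  exposure of the deep re-cut, although `TypChain` reads the walls).

NOT PROVED, NOT CLAIMED: the wire itself (thermal stability of patchwork-film surface order uniformly in the face size, a Peierls step for
three-dimensional films in four-dimensional `SU(2)` gauge theory).  ZERO-TEMPERATURE SHADOW (kit, `--workitem stmt-QuantumFields-19354`, script
`dustfilm/film.py` = GEN 2's `kitfilm/film.py` j263436 + designs; `SU(2)` Wilson slab = one designed frozen face layer + `h` free layers, T = 0
multistart quench, tuned two-state degeneracies along a one-parameter deformation SUPPORTED ON THE DESIGNED LINKS ONLY (so the tuning family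
stays in the class), domain walls on a slab of `M` supercells; decision rule of memo §7.2 fixed before the numbers):
* PERIODIC rough faces (GEN 2, j263436∕j263542∕j263658; memo §7.2): `haar` faces (i.i.d. Haar links on the whole face, period `P = 4`) are
  two-state at tuned points with converged positive wall tension `τ_∞ ≈ 0.012–0.020` (wall width `4–8` lattice units, `h`-robust, surface-localised),
  `z2pert` `τ_∞ ≈ 0.038`; `weak0.7` 12∕12 and `const` 2∕2 tuned points have NO stable wall.  By `boxConfig_mem_typChain` such faces, cut to boxes
  of side `ℓ₀ − 1`, are admitted by `TypChain … ℓ₀` at every `θ > 0`.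
* Scale `ℓ = 1` («dust»: one `ℓ∞`-diameter-1 frustrated cluster per `(4ℤ)³` block, 4–12 bad plaquettes per cluster at `θ ∈ {1/2, 1}`, designs
  `dustL0.75`∕`dustH`∕`dustX`∕`dustXsub0.15`, GEN 13 j289201∕j289202): `32∕32` tasks (`P ∈ {4, 8}`, `h ∈ {3, 5}`, 2–3 seeds, 8 quench starts) have
  EXACTLY ONE zero-temperature surface state (`P = 8` reproduces the `P = 4` state: no staggered order) — nothing to tune, no wall: dust does NOT
  carry film order at `T = 0`, consistent with afpincer-s1's j287360.
* Scales `ℓ ∈ {3, 5, 7}` (Haar boxes of side `ℓ` with clean corridors of width `3`, period `ℓ + 3`; GEN 13 j291126∕j291127∕j292622, memo §19.6):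
  `ℓ = 3`: ONE state in 4∕4 tasks (`h ∈ {3, 5}`); `ℓ = 5, 7`: glassy (1–4 physically distinct quench minima per task, splittings `4e-5 – 1.5e-3` per
  site), exactly tunable two-state coexistence in 3∕4 tasks once gauge∕symmetry copies are removed, and SHARP converged `T = 0` walls between the two
  patchwork phases — running through the clean corridor and costing only `J = 0.021∕0.025` (`ℓ = 5`, `h = 3∕5`) and `0.0009` (`ℓ = 7`) per patch wall,
  `1∕9 – 1∕300` of the periodic film's `0.18–0.28`: the corridors that make patchworks typical nearly DECOUPLE the patches at `T = 0` (Ising bond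
  `K = βJ` reaches `K_c ≈ 0.22` only at `β ≳ 9–250`), while as `β → ∞` any `J > 0` suffices at the `T = 0` level.  The census locates the coupling; it
  neither establishes nor kills the wire, and the kernel content of this file does not depend on it.
So the class of record's clause (i) is exposed to designed film order at every scale `ℓ < ℓ₀` exactly as the deep class is at every depth
`< D`; what `TypChain` buys over `TypChainDeep` is the exclusion of films needing CONNECTED rough regions of extent `≥ ℓ₀`, not of films.

Registry untouched; no new axioms (`propext`, `Classical.choice`, `Quot.sound`); nothing here bears on weak-coupling mixing, a gap, or Clay.
-/

open MeasureTheory Filter Topology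
open Literature.MathematicalPhysics.QuantumFieldTheory hiding ZdEdge
open Literature.MathematicalPhysics.QuantumLattice
open Literature.Probability.LatticeModels
open Summit.QuantumFields.YangMills.Cruxes.IR.Tempered (cellEdges windowCells regionEdges)
open Summit.QuantumFields.YangMills.Cruxes.IR.ShellTempered (windowCellsPlus)
open Summit.QuantumFields.YangMills.Cruxes.IR.FixedMesh (ClauseI)
open Summit.QuantumFields.YangMills.Theorems.OddTorusChessboard (cellPlaqs plaqAction plaqAction_congr plaqAction_one)

namespace Summit.QuantumFields.YangMills.Cruxes.IR.AfPincerUc.SharpLanes.PatchFilm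

open Summit.QuantumFields.YangMills.Cruxes.IR.AfPincerUc
open Summit.QuantumFields.YangMills.Cruxes.IR.AfPincerUc.SharpLanes

/-! ## §1 Patchwork plaquette sets; patch-clean data are short-chain typical at every larger extent -/
section Patch

variable {G : Type} [Group G] {N : ℕ} (ρ : G →* Matrix (Fin N) (Fin N) ℂ)

/-- **An `ℓ`-PATCHWORK of plaquettes**: the plaquettes of `B` carry labels such that two plaquettes of `B` whose base points are
within `ℓ∞`-distance `2` (one chain step of `HasBadChainAmong`) carry the same label, and two plaquettes of `B` with the same label
have base points within `ℓ∞`-distance `ℓ`.  (Patches of `ℓ∞`-extent `≤ ℓ`, pairwise more than `2` apart.) -/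
def IsPatchwork (B : Set (ZdPlaquette 4)) (ℓ : ℕ) : Prop :=
  ∃ lab : ZdPlaquette 4 → ℕ,
    (∀ p ∈ B, ∀ q ∈ B, supNormZ4 (p.1 - q.1) ≤ 2 → lab p = lab q) ∧
      (∀ p ∈ B, ∀ q ∈ B, lab p = lab q → supNormZ4 (p.1 - q.1) ≤ ℓ)

/-- Patchworks are monotone in the scale. -/
theorem IsPatchwork.mono {B : Set (ZdPlaquette 4)} {ℓ ℓ' : ℕ} (h : IsPatchwork B ℓ) (hℓ : ℓ ≤ ℓ') :
    IsPatchwork B ℓ' := by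
  obtain ⟨lab, h2, hd⟩ := h
  exact ⟨lab, h2, fun p hp q hq hl => (hd p hp q hq hl).trans hℓ⟩

/-- **PATCH-CLEAN data of the cell `c` at scale `ℓ`**: outside some `ℓ`-patchwork of plaquettes, every plaquette of the cell has all
four edges at the identity (so it has zero action); ON the patchwork the data are unconstrained. -/
def PatchClean (w : Fin 4 → ℤ → ℤ) (ℓ : ℕ) (c : Fin 4 → ℤ) (σ : LGConfig 4 G) : Prop :=
  ∃ B : Set (ZdPlaquette 4), IsPatchwork B ℓ ∧ ∀ p ∈ cellPlaqs w c, p ∉ B → ∀ e ∈ plaquetteEdges p, σ e = 1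

/-- Patch-cleanness is monotone in the scale. -/
theorem PatchClean.mono {w : Fin 4 → ℤ → ℤ} {ℓ ℓ' : ℕ} {c : Fin 4 → ℤ} {σ : LGConfig 4 G} (h : PatchClean w ℓ c σ)
    (hℓ : ℓ ≤ ℓ') : PatchClean w ℓ' c σ := by
  obtain ⟨B, hB, hclean⟩ := h
  exact ⟨B, hB.mono hℓ, hclean⟩

/-- **Patch-clean data at scale `ℓ` are `TypChain`-typical at every threshold `θ > 0` and every extent `ℓ₀ > ℓ` (PROVED).**  A `θ`-bad
chain consists of plaquettes of positive action, hence of patchwork plaquettes; its steps have length `≤ 2`, so the label is constant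
along it; so its end-to-end extent is `≤ ℓ < ℓ₀`. -/
theorem mem_typChain_of_patchClean {θ : ℝ} (hθ : 0 < θ) {w : Fin 4 → ℤ → ℤ} {ℓ ℓ₀ : ℕ} (hℓ : ℓ < ℓ₀) {c : Fin 4 → ℤ}
    {σ : LGConfig 4 G} (h : PatchClean w ℓ c σ) : σ ∈ TypChain ρ θ w ℓ₀ c := by
  obtain ⟨B, ⟨lab, h2, hd⟩, hclean⟩ := h
  rintro ⟨k, ch, hin, hbad, hstep, hext⟩
  have hB : ∀ i, ch i ∈ B := by
    intro i
    by_contra hi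
    have h0 : plaqAction ρ (ch i) σ = 0 := by
      rw [plaqAction_congr ρ (ch i) (V := (1 : LGConfig 4 G))
        (fun e he => by rw [hclean _ (Finset.mem_coe.1 (hin i)) hi e he]; rfl), plaqAction_one]
    have := hbad i
    rw [h0] at this
    exact absurd this (not_le.2 hθ)
  have hlab : ∀ i : Fin (k + 1), lab (ch i) = lab (ch 0) := by
    intro i
    induction i using Fin.induction with
    | zero => rfl
    | succ i ih => rw [← ih]; exact (h2 _ (hB i.castSucc) _ (hB i.succ) (hstep i)).symm
  have hle : supNormZ4 ((ch 0).1 - (ch (Fin.last k)).1) ≤ ℓ := hd _ (hB 0) _ (hB _) (hlab _).symm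
  exact absurd (hext.trans hle) (not_le.2 hℓ)

/-! ### Explicit members: ARBITRARY data on a box of side `ℓ` are admitted at every extent `ℓ₀ > ℓ` -/

/-- The plaquettes NEAR the box `x₀ + [0, ℓ)⁴`: base point in `x₀ + [−1, ℓ)⁴` (every plaquette with an edge based in the box). -/
def nearBox (x₀ : Site 4) (ℓ : ℕ) : Set (ZdPlaquette 4) :=
  {p | ∀ i, x₀ i - 1 ≤ p.1 i ∧ p.1 i < x₀ i + ℓ}

/-- The plaquettes near a box of side `ℓ` form ONE patch of extent `≤ ℓ`. -/
theorem isPatchwork_nearBox (x₀ : Site 4) (ℓ : ℕ) : IsPatchwork (nearBox x₀ ℓ) ℓ := by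
  refine ⟨fun _ => 0, fun _ _ _ _ _ => rfl, fun p hp q hq _ => ?_⟩
  rw [supNormZ4_sub_le_iff_abs]
  intro i
  obtain ⟨hp1, hp2⟩ := hp i
  obtain ⟨hq1, hq2⟩ := hq i
  rw [abs_le]
  constructor <;> omega

/-- **BOX DATA**: prescribed group elements `τ e` on the edges based in the box `x₀ + [0, ℓ)⁴`, the identity elsewhere. -/
def boxConfig (x₀ : Site 4) (ℓ : ℕ) (τ : ZdEdge 4 → G) : LGConfig 4 G :=
  fun e => if ∀ i, x₀ i ≤ e.1 i ∧ e.1 i < x₀ i + ℓ then τ e else 1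

/-- A plaquette with an edge based in the box is near the box. -/
theorem mem_nearBox_of_edge {x₀ : Site 4} {ℓ : ℕ} {p : ZdPlaquette 4} {e : ZdEdge 4} (he : e ∈ plaquetteEdges p)
    (hbox : ∀ i, x₀ i ≤ e.1 i ∧ e.1 i < x₀ i + ℓ) : p ∈ nearBox x₀ ℓ := by
  simp only [plaquetteEdges, Finset.mem_insert, Finset.mem_singleton] at he
  intro i
  obtain ⟨h1, h2⟩ := hbox i
  rcases he with rfl | rfl | rfl | rfl
  · dsimp only at h1 h2
    exact ⟨by omega, by omega⟩
  · simp only [Pi.add_apply, Pi.single_apply] at h1 h2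
    split_ifs at h1 h2 <;> exact ⟨by omega, by omega⟩
  · simp only [Pi.add_apply, Pi.single_apply] at h1 h2
    split_ifs at h1 h2 <;> exact ⟨by omega, by omega⟩
  · dsimp only at h1 h2
    exact ⟨by omega, by omega⟩

/-- **Box data are patch-clean at scale `ℓ` in EVERY cell of EVERY frame (PROVED).** -/
theorem patchClean_boxConfig (w : Fin 4 → ℤ → ℤ) (c : Fin 4 → ℤ) (x₀ : Site 4) (ℓ : ℕ) (τ : ZdEdge 4 → G) :
    PatchClean w ℓ c (boxConfig x₀ ℓ τ) := by
  refine ⟨nearBox x₀ ℓ, isPatchwork_nearBox x₀ ℓ, fun p _ hp e he => ?_⟩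
  unfold boxConfig
  split_ifs with hbox
  · exact absurd (mem_nearBox_of_edge he hbox) hp
  · rfl

/-- **`TypChain` at extent `ℓ₀` admits ARBITRARY data on every box of side `< ℓ₀`, in every cell of every frame, at every `θ > 0`
(PROVED)** — in particular the GEN 2 film designs (`haar`, `z2pert`) cut to boxes of side `ℓ₀ − 1`. -/
theorem boxConfig_mem_typChain {θ : ℝ} (hθ : 0 < θ) (w : Fin 4 → ℤ → ℤ) {ℓ ℓ₀ : ℕ} (hℓ : ℓ < ℓ₀) (c : Fin 4 → ℤ)
    (x₀ : Site 4) (τ : ZdEdge 4 → G) : boxConfig x₀ ℓ τ ∈ TypChain ρ θ w ℓ₀ c :=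
  mem_typChain_of_patchClean ρ hθ hℓ (patchClean_boxConfig w c x₀ ℓ τ)

end Patch

/-! ## §2 The patch-film wire, typed against `FixedMesh.ClauseI` -/
section Wire

variable {G : Type} [Group G] [TopologicalSpace G] [IsTopologicalGroup G] [CompactSpace G]
  [MeasurableSpace G] [BorelSpace G]

/-- **The patch-film wire at scale `ℓ`, window parameter `n`, contrast `η`** for the Wilson kernels of `ρ`: from some coupling `β₀` on,
at EVERY mesh `b ≥ 1` some mesh-`b` frame `w` carries an admissible resampled family `Y ∋ 0` inside the radius-`n` window and a pair of
data `σ, σ'` — both PATCH-CLEAN at scale `ℓ` on every cell of window+shell off `Y` (hence `TypChain`-typical there for every `θ > 0` and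
every extent `ℓ₀ > ℓ`, §1; on the patchworks — e.g. faces tiled by rough boxes of side `ℓ` separated by clean corridors of width `3`, and
phase-selecting caps in the shell — they are free) and EQUAL on the window cells off `Y` — whose `Y`-kernels differ by MORE than `η` on some
`[0,1]`-valued measurable cylinder observable of the centre cell.  NOT proved here (surface order of patchwork face films: a thermal Peierls
step); its zero-temperature shadow is the patch-film census quoted in the module docstring. -/
def PatchFilmWireAt {N : ℕ} (ρ : G →* Matrix (Fin N) (Fin N) ℂ) (ℓ n : ℕ) (η : ℝ) : Prop :=
  ∃ β₀ : ℝ, ∀ β : ℝ, β₀ ≤ β → ∀ b : ℕ, 1 ≤ b → ∃ w : Fin 4 → ℤ → ℤ, IsFrame b w ∧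
    ∃ Y : Finset (Fin 4 → ℤ), Y ⊆ windowCells n ∧ (0 : Fin 4 → ℤ) ∈ Y ∧
      ∃ σ σ' : LGConfig 4 G,
        (∀ c ∈ windowCellsPlus n, c ∉ Y → PatchClean w ℓ c σ ∧ PatchClean w ℓ c σ') ∧
        (∀ c ∈ windowCellsPlus n, c ∉ Y → c ∈ windowCells n → ∀ e ∈ cellEdges w c, σ e = σ' e) ∧
        ∃ f : LGConfig 4 G → ℝ, IsCylinder f (cellEdges w 0) ∧ Measurable f ∧ (∀ U, 0 ≤ f U ∧ f U ≤ 1) ∧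
          η < |(∫ U, f U ∂(ymSpecification ρ β (regionEdges w Y) σ)) -
                ∫ U, f U ∂(ymSpecification ρ β (regionEdges w Y) σ')|

variable {N : ℕ} (ρ : G →* Matrix (Fin N) (Fin N) ℂ)

/-- The wire is monotone in the scale and antitone in the contrast. -/
theorem PatchFilmWireAt.mono {ℓ ℓ' n : ℕ} {η η' : ℝ} (hℓ : ℓ ≤ ℓ') (hη : η' ≤ η) (h : PatchFilmWireAt ρ ℓ n η) :
    PatchFilmWireAt ρ ℓ' n η' := by
  obtain ⟨β₀, h⟩ := h
  refine ⟨β₀, fun β hβ b hb => ?_⟩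
  obtain ⟨w, hw, Y, hY, h0, σ, σ', hclean, hagree, f, hf, hfm, hf01, hgap⟩ := h β hβ b hb
  exact ⟨w, hw, Y, hY, h0, σ, σ', fun c hc hcY => ⟨(hclean c hc hcY).1.mono hℓ, (hclean c hc hcY).2.mono hℓ⟩, hagree,
    f, hf, hfm, hf01, hη.trans_lt hgap⟩

/-- **One instance of the wire's data refutes clause (i) for `TypChain` at every `θ > 0`, every extent `ℓ₀ > ℓ`, every `ε ≤ η`
(PROVED)** — the data are typical by `mem_typChain_of_patchClean`, and `ClauseI` bounds the very difference the instance makes `> η`. -/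
theorem not_clauseI_typChain_of_instance {β θ ε η : ℝ} (hθ : 0 < θ) (hε : ε ≤ η) {w : Fin 4 → ℤ → ℤ} {n ℓ ℓ₀ : ℕ}
    (hℓ : ℓ < ℓ₀) {Y : Finset (Fin 4 → ℤ)} (hY : Y ⊆ windowCells n) (h0 : (0 : Fin 4 → ℤ) ∈ Y) {σ σ' : LGConfig 4 G}
    (hclean : ∀ c ∈ windowCellsPlus n, c ∉ Y → PatchClean w ℓ c σ ∧ PatchClean w ℓ c σ')
    (hagree : ∀ c ∈ windowCellsPlus n, c ∉ Y → c ∈ windowCells n → ∀ e ∈ cellEdges w c, σ e = σ' e)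
    {f : LGConfig 4 G → ℝ} (hf : IsCylinder f (cellEdges w 0)) (hfm : Measurable f) (hf01 : ∀ U, 0 ≤ f U ∧ f U ≤ 1)
    (hgap : η < |(∫ U, f U ∂(ymSpecification ρ β (regionEdges w Y) σ)) - ∫ U, f U ∂(ymSpecification ρ β (regionEdges w Y) σ')|) :
    ¬ ClauseI ρ β w n ε (TypChain ρ θ w ℓ₀) := by
  intro hI
  have hle := hI Y hY h0 σ σ' (fun c hc hcY =>
    ⟨mem_typChain_of_patchClean ρ hθ hℓ (hclean c hc hcY).1,
      mem_typChain_of_patchClean ρ hθ hℓ (hclean c hc hcY).2⟩) hagree f hf hfm hf01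
  exact (lt_irrefl η) ((hgap.trans_le hle).trans_le hε)

/-- **The wire kills the (i)-demand of `TypChain` at every extent above its scale, at EVERY mesh (PROVED):** under
`PatchFilmWireAt ρ ℓ n η`, for all large `β`, every mesh `b ≥ 1`, every `θ > 0`, every `ε ≤ η` and every `ℓ₀ > ℓ`, some mesh-`b` frame
violates `ClauseI` — hence `ClauseIAll` — for `TypChain ρ θ w ℓ₀`. -/
theorem exists_frame_not_clauseIAll_of_wireAt {ℓ n : ℕ} {η : ℝ} (hW : PatchFilmWireAt ρ ℓ n η) :
    ∃ β₀ : ℝ, ∀ β : ℝ, β₀ ≤ β → ∀ b : ℕ, 1 ≤ b → ∀ θ : ℝ, 0 < θ → ∀ ε : ℝ, ε ≤ η → ∀ ℓ₀ : ℕ, ℓ < ℓ₀ →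
      ∃ w : Fin 4 → ℤ → ℤ, IsFrame b w ∧ ¬ ClauseI ρ β w n ε (TypChain ρ θ w ℓ₀) ∧
        ¬ ClauseIAll ρ β w n ε (TypChain ρ θ w ℓ₀) := by
  obtain ⟨β₀, h⟩ := hW
  refine ⟨β₀, fun β hβ b hb θ hθ ε hε ℓ₀ hℓ => ?_⟩
  obtain ⟨w, hw, Y, hY, h0, σ, σ', hclean, hagree, f, hf, hfm, hf01, hgap⟩ := h β hβ b hb
  have hnot := not_clauseI_typChain_of_instance ρ hθ hε hℓ hY h0 hclean hagree hf hfm hf01 hgap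
  exact ⟨w, hw, hnot, fun hAll => hnot (DeepFilm.clauseI_of_clauseIAll ρ hAll)⟩

end Wire

/-! ## §3 Supplier-level consequences: every `TypChain` supplier prints its extent BELOW the patch-film scale -/
section Supplier

open Summit.QuantumFields.YangMills.Cruxes.OSLegsFromFemtoAndGap.DlrCollarTransfer (LowerBounds)

/-- **Every witness of `TypChainSharpSC` avoids the patch-film wire at every scale below its printed extent (PROVED).**  At any SC
datum `(G, r, a)` with `LowerBounds`, a supplier of `TypChainSharpSC` prints `(n, ε, θ, ℓ₀)` such that, if `θ > 0`,
`¬ PatchFilmWireAt r.ρ ℓ n η` for every scale `ℓ < ℓ₀` and every contrast `η ≥ 1/16` (its `ε` is `≤ 1/16`): a supplier proving clause (i)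
for `TypChain … ℓ₀` thereby refutes film order for EVERY patchwork design of scale `< ℓ₀` at its own window parameter — while clause
(ii) obliges it to take `ℓ₀` above the length of the bad chains a typical mesh-`b` cell carries.  Calibration, not a refutation. -/
theorem typChainSharpSC_avoids_patchWire (h : TypChainSharpSC) (G : Type) [Group G] [TopologicalSpace G]
    [IsTopologicalGroup G] [CompactSpace G] (hG : IsCompactSimpleLieGroup G) (hsc : SimplyConnectedSpace G) :
    letI : MeasurableSpace G := borel G
    haveI : BorelSpace G := ⟨rfl⟩
    ∀ (r : LatticeRep G) (a : ℝ → ℝ), (∀ β, 0 < a β) → Tendsto a atTop (𝓝 0) → LowerBounds G r a →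
      ∃ (n : ℕ) (ε : ℝ) (θ : ℝ) (ℓ₀ : ℕ),
        (0 < θ → ∀ η : ℝ, 1 / 16 ≤ η → ∀ ℓ : ℕ, ℓ < ℓ₀ → ¬ PatchFilmWireAt r.ρ ℓ n η) ∧
        1 ≤ n ∧ 0 ≤ ε ∧ ε * OnsetFormats.shellCount n ≤ 3 / 4 ∧
        ∀ δ : ℝ, 0 < δ → ∃ T β₂ : ℝ, ∀ β : ℝ, β₂ ≤ β → ∃ b : ℕ, 1 ≤ b ∧ a β * (b : ℝ) < T ∧
          ∀ w : Fin 4 → ℤ → ℤ, IsFrame b w →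
            ClauseIAll r.ρ β w n ε (TypChain r.ρ θ w ℓ₀) ∧ ClauseIIukp r.ρ β w δ (TypChain r.ρ θ w ℓ₀) ∧
              ClauseIII r.ρ β w b δ (TypChain r.ρ θ w ℓ₀) := by
  letI : MeasurableSpace G := borel G
  haveI : BorelSpace G := ⟨rfl⟩
  intro r a ha hat hlb
  obtain ⟨n, ε, θ, ℓ₀, hn, hε, hM, hsup⟩ := h G hG hsc r a ha hat hlb
  refine ⟨n, ε, θ, ℓ₀, fun hθ η hη ℓ hℓ hW => ?_, hn, hε, hM, hsup⟩
  obtain ⟨β₀, hβ₀⟩ := exists_frame_not_clauseIAll_of_wireAt r.ρ hW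
  obtain ⟨T, β₂, hβ₂⟩ := hsup 1 one_pos
  obtain ⟨b, hb1, -, hframes⟩ := hβ₂ (max β₀ β₂) (le_max_right _ _)
  obtain ⟨w, hw, -, hnot⟩ :=
    hβ₀ (max β₀ β₂) (le_max_left _ _) b hb1 θ hθ ε ((SharpOnset.eps_le_sixteenth hε hM).trans hη) ℓ₀ hℓ
  exact hnot (hframes w hw).1

/-- **Every witness of the REDUCED statement `TypChainReducedAtSC` avoids the patch-film wire at every scale below
`extentOf θ κ C = 2 · max ⌈48 C⁺/θ⌉₊ ⌈4 C⁺/κ⌉₊` (PROVED):** the printed `(n, ε, θ, κ, C)` (`θ > 0` is part of the statement) satisfy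
`¬ PatchFilmWireAt r.ρ ℓ n η` for every `ℓ < extentOf θ κ C` and every `η ≥ 1/16` — the larger the mesh growth `C` the supplier needs
(`b ≤ B e^{Cβ}` with `a β · b < T`), the larger the patchwork films whose order it must exclude. -/
theorem typChainReducedAtSC_avoids_patchWire (h : TypChainReducedAtSC) (G : Type) [Group G] [TopologicalSpace G]
    [IsTopologicalGroup G] [CompactSpace G] (hG : IsCompactSimpleLieGroup G) (hsc : SimplyConnectedSpace G) :
    letI : MeasurableSpace G := borel G
    haveI : BorelSpace G := ⟨rfl⟩
    ∀ (r : LatticeRep G) (a : ℝ → ℝ), (∀ β, 0 < a β) → Tendsto a atTop (𝓝 0) → LowerBounds G r a →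
      ∃ (n : ℕ) (ε θ κ C : ℝ),
        (∀ η : ℝ, 1 / 16 ≤ η → ∀ ℓ : ℕ, ℓ < extentOf θ κ C → ¬ PatchFilmWireAt r.ρ ℓ n η) ∧
        1 ≤ n ∧ 0 ≤ ε ∧ ε * OnsetFormats.shellCount n ≤ 3 / 4 ∧ 0 < θ ∧ 0 < κ ∧
        ∀ δ : ℝ, 0 < δ → ∃ T B β₂ : ℝ, ∀ β : ℝ, β₂ ≤ β →
          ∃ b : ℕ, 1 ≤ b ∧ a β * (b : ℝ) < T ∧ (b : ℝ) ≤ B * Real.exp (C * β) ∧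
            ∀ w : Fin 4 → ℤ → ℤ, IsFrame b w →
              ClauseIAll r.ρ β w n ε (TypChain r.ρ θ w (extentOf θ κ C)) ∧
                KernelPlaqSparse r.ρ β w θ (extentOf θ κ C) (Real.exp (-(κ * β))) := by
  letI : MeasurableSpace G := borel G
  haveI : BorelSpace G := ⟨rfl⟩
  intro r a ha hat hlb
  obtain ⟨n, ε, θ, κ, C, hn, hε, hM, hθ, hκ, hsup⟩ := h G hG hsc r a ha hat hlb
  refine ⟨n, ε, θ, κ, C, fun η hη ℓ hℓ hW => ?_, hn, hε, hM, hθ, hκ, hsup⟩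
  obtain ⟨β₀, hβ₀⟩ := exists_frame_not_clauseIAll_of_wireAt r.ρ hW
  obtain ⟨T, B, β₂, hβ₂⟩ := hsup 1 one_pos
  obtain ⟨b, hb1, -, -, hframes⟩ := hβ₂ (max β₀ β₂) (le_max_right _ _)
  obtain ⟨w, hw, -, hnot⟩ :=
    hβ₀ (max β₀ β₂) (le_max_left _ _) b hb1 θ hθ ε ((SharpOnset.eps_le_sixteenth hε hM).trans hη) (extentOf θ κ C) hℓ
  exact hnot (hframes w hw).1

/-- **Every witness of the EVERY-EXTENT statement `TypChainReducedSC` avoids the patch-film wire at EVERY scale (PROVED):** since it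
claims clause (i) for `TypChain … ℓ₀` for ALL `ℓ₀` with one `(n, ε, θ)`, its printed data satisfy `¬ PatchFilmWireAt r.ρ ℓ n η` for every
`ℓ` and every `η ≥ 1/16` — it must exclude film order for patchwork faces of EVERY size, exactly the exposure of the deep re-cut
(`DeepFilm.typChainDeepSharpSC_avoids_filmWire`, p562545) that the wall-reading of `TypChain` was meant to avoid. -/
theorem typChainReducedSC_avoids_patchWire_all_scales (h : TypChainReducedSC) (G : Type) [Group G] [TopologicalSpace G]
    [IsTopologicalGroup G] [CompactSpace G] (hG : IsCompactSimpleLieGroup G) (hsc : SimplyConnectedSpace G) :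
    letI : MeasurableSpace G := borel G
    haveI : BorelSpace G := ⟨rfl⟩
    ∀ (r : LatticeRep G) (a : ℝ → ℝ), (∀ β, 0 < a β) → Tendsto a atTop (𝓝 0) → LowerBounds G r a →
      ∃ (n : ℕ) (ε θ κ C : ℝ),
        (∀ η : ℝ, 1 / 16 ≤ η → ∀ ℓ : ℕ, ¬ PatchFilmWireAt r.ρ ℓ n η) ∧
        1 ≤ n ∧ 0 ≤ ε ∧ ε * OnsetFormats.shellCount n ≤ 3 / 4 ∧ 0 < θ ∧ 0 < κ ∧
        ∀ ℓ₀ : ℕ, ∀ δ : ℝ, 0 < δ → ∃ T B β₂ : ℝ, ∀ β : ℝ, β₂ ≤ β →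
          ∃ b : ℕ, 1 ≤ b ∧ a β * (b : ℝ) < T ∧ (b : ℝ) ≤ B * Real.exp (C * β) ∧
            ∀ w : Fin 4 → ℤ → ℤ, IsFrame b w →
              ClauseIAll r.ρ β w n ε (TypChain r.ρ θ w ℓ₀) ∧
                KernelPlaqSparse r.ρ β w θ ℓ₀ (Real.exp (-(κ * β))) := by
  letI : MeasurableSpace G := borel G
  haveI : BorelSpace G := ⟨rfl⟩
  intro r a ha hat hlb
  obtain ⟨n, ε, θ, κ, C, hn, hε, hM, hθ, hκ, hsup⟩ := h G hG hsc r a ha hat hlb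
  refine ⟨n, ε, θ, κ, C, fun η hη ℓ hW => ?_, hn, hε, hM, hθ, hκ, hsup⟩
  obtain ⟨β₀, hβ₀⟩ := exists_frame_not_clauseIAll_of_wireAt r.ρ hW
  obtain ⟨T, B, β₂, hβ₂⟩ := hsup (ℓ + 1) 1 one_pos
  obtain ⟨b, hb1, -, -, hframes⟩ := hβ₂ (max β₀ β₂) (le_max_right _ _)
  obtain ⟨w, hw, -, hnot⟩ :=
    hβ₀ (max β₀ β₂) (le_max_left _ _) b hb1 θ hθ ε ((SharpOnset.eps_le_sixteenth hε hM).trans hη) (ℓ + 1) (Nat.lt_succ_self ℓ)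
  exact hnot (hframes w hw).1

end Supplier

end Summit.QuantumFields.YangMills.Cruxes.IR.AfPincerUc.SharpLanes.PatchFilm
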